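import Summits.BirchSwinnertonDyer.Rank1Residual.Additive.RamifiedOrdinaryLineHalfPowerCore
import Summits.BirchSwinnertonDyer.Rank1Residual.Additive.RamifiedOrdinaryLineExponentTwo
import Literature.NumberTheory.EllipticCurves.QuadraticBaseChangeGaloisProofs
import Literature.NumberTheory.GaloisRepresentations.ImaginaryQuadraticCyclotomicProofs
import Literature.NumberTheory.GaloisRepresentations.TateLevelOneWildOdd
import HarnessLib

/-!
# The HALF-POWER of inertia on the ramified ordinary line, DEFECT 2 at `p ≡ 3 (mod 4)`:
# `σ^{(p−1)/2}` is trivial on `C[p]` on every (G-ord, `e = 2`) and every (M) row — the (P-def2-odd)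
# producer (cell `b2b-bsdres`, CLASS-CLOSURE typer 2 = literature seat of record N10 §3.2 / O7 §3.3;
# `class-closure/N10/TRANSPORT-TEMPLATE.md` v2.1 §PRODUCERS, the `e = 2` slot left open by p16's Q4
# `RamifiedOrdinaryLineHalfPower` (`he2`) and by p07's F3b `RamifiedOrdinaryLineExactOrder`)

HONEST FRAMING (cell `b2b-bsdres`, run/shared/lean/b2b/bsd-rank1-residual/, verbatim in every
file): the goal of the cell is to DELETE the COMBINATION-SHAPED residual classes of the
Birch–Swinnerton-Dyer formula for ALL analytic-rank `≤ 1` elliptic curves over `ℚ` — "full BSD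
formula for every rank `≤ 1` curve in class `C`" assembled STRICTLY from published theorems — so
that the rank-`≤ 1` remainder becomes exactly the CONSTRUCTION-SHAPED classes, which are TYPED
(missing-input `Prop`s), NOT attempted. This is not "finishing BSD". Lane CLASS-CLOSURE (N10 / O7):
prove what is provable now; shrink each hard class to its core with data; no claim beyond stated
classes; census output = EVIDENCE, never a Literature fact; RESIDUAL-MAP marks UNCHANGED; nothing is
booked by this file. TOOL theorems only: NO definition, NO named fact, NO conjecture node. §4 and the
(M) ENDs are CONDITIONAL on the tree's EXISTING named facts A40/A41 (Silverman *ATAEC* V.5.3 / V.5.4: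
hypotheses `hT40`, `hT41`) exactly as the consumed (M) line file; everything else is unconditional.

## What and why

The parity dictionary of `N10/TRANSPORT-TEMPLATE.md` v2.1 reads the LINE character of inertia on
the ramified ordinary line `C ⊂ E[p^∞]` (`IsRamifiedOrdinaryLine`) at the exponent `(p−1)/2`:
`hℓ : ∀ σ ∈ I_v, ∀ m ∈ C, p·m = 0 → σ^{(p−1)/2} m = m` ("line-even", the `hℓ` binder of S4
`RamifiedOrdinaryLineMatchingLineExponent.inclusion_mem_iff_of_lineHalfPow` and of S4b's no-matching
theorems). p16's Q4 produced `hℓ` on (G-ord) rows with even defect `e ≠ 2`; the DEFECT-2 rows — (G-ord,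
`e = 2`) and (M) — are line-even exactly at `p ≡ 3 (mod 4)`, and this file proves it. On such a row
`E = V ⊗ χ_{p*}` with `V` good ORDINARY (resp. MULTIPLICATIVE) at `p`; `C = t(C_V)` is the transport
of Greenberg's kernel-of-reduction line (resp. the Tate line) of `V` along the twisting isomorphism
`t`, and inertia acts TRIVIALLY on `V[p^∞]/C_V`. Since `t(σ x) = χ_{p*}(σ) σ t(x)` and
`χ_{p*}(σ) = (χ̄_p(σ)/p)` (the quadratic subfield of `ℚ(ζ_p)` is `ℚ(√p*)`: Gauss sum), every inertial
`σ` acts on `E[p^∞]/C` as the SIGN `(χ̄_p(σ)/p)` — the hypothesis of p16's model-free core Q3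
`IsRamifiedOrdinaryLine.lineHalfPow_of_quotSign` at `n = 1`, `k = (p−1)/2`, which is ODD iff
`p ≡ 3 (mod 4)`. (Weil pairing: the line character is then `(χ̄_p/p)·χ̄_p`, and
`((a/p) a)^{(p−1)/2} = (a/p)^{(p+1)/2} = 1`.)

* §1 `transport_smul_sub_sign_smul_mem` (generic): inertia trivial on `M₁/C` and `e : M₁ ≃+ M₂`
  `ε(σ)`-equivariant (`ε = ±1`) at each inertial `σ` ⟹ `σ` acts on `M₂/e(C)` as `ε(σ)`.
* §2 `smul_geomSqrt_pStar`: `τ • √p* = (χ̄_p(τ)/p) √p*` (`Rat.exists_gaussSum`); local form with the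
  LOCAL mod-`p` cyclotomic character (`modNCyclotomicCharacter_absGaloisRestrict`).
* §3 (G-ord, `e = 2`) `exists_isRamifiedOrdinaryLine_and_sign_of_goodOrd_pStar_twist` / `…_of_typeGOrd`:
  p10's transported line (B0 §2 verbatim) WITH the sign on its quotient; §4 (M)
  `PotMult.exists_isRamifiedOrdinaryLine_and_sign`: p07's transported Tate line with its quotient SHAPE,
  the branch `res σ ∈ galRange ℚ(√p*)` decided by the sign (`mem_range_absGaloisRestrict_of_smul_geomSqrt`).
* §5 ENDs for EVERY ramified ordinary line (model-free uniqueness):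
  **`IsRamifiedOrdinaryLine.lineHalfPow_of_typeGOrd_of_semistabilityIndex_eq_two (hp3 : p % 4 = 3)`**
  (TT v2.1's typed (P-def2-odd) statement binder-for-binder) and **`PotMult.lineHalfPow`**.
The class forms, the total parity dichotomy (with p16's `GordMixedParityNoMatching`: quotient-even at
`p ≡ 1 (mod 4)`) and the dead mixed links with a defect-2 member are the sequel `DefectTwoParity.lean`.

HONEST LIMIT: a TOOL step of the R3″ / Route-G line transports, not an END; at `p = 3` every N10 row
is defect 2 and line-even (`ℓ = 1`: the line's `p`-torsion is UNRAMIFIED, p12's flipped line), whose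
congruent-pair consumers run on the `hGV` road without an `hlines` binder — no per-pair closure is
claimed; census −0; nothing booked.

References: R. Greenberg, LNM 1716 (1999) §2 pp. 62–63, 69 [GreenbergLNM1716]; R. Greenberg,
V. Vatsal, Invent. Math. 142 (2000) §2 pp. 14–15, 26 [GreenbergVatsal2000]; M. Emerton, R. Pollack,
T. Weston, Invent. Math. 163 (2006) §3.1 (arXiv:math/0404484 p. 17) [EmertonPollackWeston2006];
K. Ireland, M. Rosen, *A Classical Introduction to Modern Number Theory* Prop. 6.3.2 [IrelandRosen1990];
J. H. Silverman, *AEC* III.8.1, X.5 Cor. 5.4 [SilvermanAEC2009]; *ATAEC* V.5.3, V.5.4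
[SilvermanATAEC1994]; class-closure/N10/TRANSPORT-TEMPLATE.md v2.1 §PRODUCERS (P-def2-odd).
-/

set_option autoImplicit false

noncomputable section

open scoped Classical NumberField

open NumberField IsDedekindDomain Field WeierstrassCurve
  Literature.NumberTheory.GaloisRepresentations
  Literature.NumberTheory.EllipticCurves
  Literature.NumberTheory.EllipticCurves.Rank1Residual
  Literature.NumberTheory.EllipticCurves.GreenbergSelmer
  Literature.NumberTheory.EllipticCurves.EmertonPollackWeston2006
  IsDedekindDomain.HeightOneSpectrum
  Summit.BirchSwinnertonDyer.Rank1Residual.X2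
  Summit.BirchSwinnertonDyer.Rank1Residual.X2.GreenbergVatsalReductionDatum
open WeierstrassCurve (minimalDiscriminantInt)

universe u

namespace Summit.BirchSwinnertonDyer.Rank1Residual.Additive

namespace RamifiedOrdinaryLineHalfPowerTwo

/-! ### §1 A sign-equivariant transport: "inertia trivial on `M₁/C`" ⟹ "inertia = sign on `M₂/e(C)`" -/

section Generic

variable {K : Type u} [Field K] [NumberField K] {v : HeightOneSpectrum (𝓞 K)}
  {M₁ M₂ : Type u} [AddCommGroup M₁] [AddCommGroup M₂]
  [DistribMulAction (absoluteGaloisGroup K) M₁] [DistribMulAction (absoluteGaloisGroup K) M₂]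
  (L : LocalDatum K M₁ v) (e : M₁ ≃+ M₂)
  (L₂ : LocalDatum K M₂ v) (hL₂ : ∀ m : M₂, m ∈ L₂.plus ↔ e.symm m ∈ L.plus)

include hL₂ in
/-- **Inertia acts on `M₂/e(C)` as the sign of `e`.** Let `L₂` be a transport of the local datum `L`
(`C = L.plus`) along `e : M₁ ≃+ M₂` (`m ∈ L₂.plus ↔ e⁻¹ m ∈ C`), let inertia act TRIVIALLY on `M₁/C`,
and let `ε(σ) ∈ {±1}` record the sign of `e` at each local inertia element `σ`
(`e(σ m) = ε(σ) σ e(m)`). Then `σ • m − ε(σ) • m ∈ e(C)` for every `m ∈ M₂`: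
`σ e(m₁) ∓ e(m₁) = ±e(σ m₁ − m₁)`. (EPW §3.1: `A''_{f̃,a} = (V[p^∞]/C_V) ⊗ χ`.)
[cite: EmertonPollackWeston2006, §3.1 (eq:ordes) (arXiv:math/0404484 p. 17)] -/
theorem transport_smul_sub_sign_smul_mem
    (htriv : ∀ x ∈ inertia v, ∀ m : M₁, x • m - m ∈ L.plus)
    (ε : absoluteGaloisGroup (v.adicCompletion K) → ℤ)
    (hε : ∀ σ ∈ absInertia (v.adicCompletion K),
      (ε σ = 1 ∧ ∀ m, e (absGaloisRestrict K (v.adicCompletion K) σ • m) =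
          absGaloisRestrict K (v.adicCompletion K) σ • e m) ∨
      (ε σ = -1 ∧ ∀ m, e (absGaloisRestrict K (v.adicCompletion K) σ • m) =
          -(absGaloisRestrict K (v.adicCompletion K) σ • e m))) :
    ∀ σ ∈ absInertia (v.adicCompletion K), ∀ m : M₂,
      absGaloisRestrict K (v.adicCompletion K) σ • m - ε σ • m ∈ L₂.plus := by
  intro σ hσ m
  have hxI : absGaloisRestrict K (v.adicCompletion K) σ ∈ inertia v :=
    Subgroup.mem_map.2 ⟨σ, hσ, rfl⟩
  set x := absGaloisRestrict K (v.adicCompletion K) σ with hx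
  have hmem : e (x • e.symm m - e.symm m) ∈ L₂.plus := by
    rw [hL₂, e.symm_apply_apply]
    exact htriv x hxI _
  rcases hε σ hσ with ⟨h1, hpos⟩ | ⟨h1, hneg⟩
  · have heq : x • m - m = e (x • e.symm m - e.symm m) := by
      rw [map_sub, hpos, e.apply_symm_apply]
    rw [h1, one_zsmul, heq]
    exact hmem
  · have heq : x • m + m = -e (x • e.symm m - e.symm m) := by
      rw [map_sub, hneg, e.apply_symm_apply]
      abel
    rw [h1, neg_one_zsmul, sub_neg_eq_add, heq]
    exact neg_mem hmem

end Generic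

/-! ### §2 `σ√p* = (χ̄_p(σ)/p) √p*`: the character of `ℚ(√p*)` IS the Legendre symbol of `χ̄_p` -/

section PStar

variable (p : ℕ) [hp : Fact p.Prime]

/-- **`τ • √p* = (χ̄_p(τ)/p) · √p*` for every `τ ∈ Γ_ℚ`**, `p* = (−1)^{⌊p/2⌋} p`, `p` odd: the Gauss
sum `s = Σ_a (a/p) ζ_p^a ∈ ℚ̄` has `s² = (−1/p) p = p*` and `τ s = (χ̄_p(τ)/p) s` (the tree's
`Rat.exists_gaussSum`; Ireland–Rosen Prop. 6.3.2), and `√p* = ±s`.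
[cite: IrelandRosen1990, Ch. 6 Prop. 6.3.2] -/
theorem smul_geomSqrt_pStar (hp2 : p ≠ 2) (τ : absoluteGaloisGroup ℚ) :
    τ • geomSqrt ((-1 : ℚ) ^ (p / 2) * p) =
      ((quadraticChar (ZMod p) ((modNCyclotomicCharacter ℚ p τ : (ZMod p)ˣ) : ZMod p) : ℤ) :
        AlgebraicClosure ℚ) * geomSqrt ((-1 : ℚ) ^ (p / 2) * p) := by
  haveI : NeZero (p : ℚ) := ⟨Nat.cast_ne_zero.mpr hp.out.ne_zero⟩
  obtain ⟨s, -, hs2, hsτ⟩ := Rat.exists_gaussSum (p := p) hp2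
  have hpchar : ringChar (ZMod p) ≠ 2 := by rwa [ZMod.ringChar_zmod_n]
  have hodd : p % 2 = 1 := Nat.odd_iff.mp (hp.out.odd_of_ne_two hp2)
  have hneg1 : ((quadraticChar (ZMod p) (-1) : ℤ) : AlgebraicClosure ℚ) =
      (-1 : AlgebraicClosure ℚ) ^ (p / 2) := by
    rw [quadraticChar_neg_one hpchar, ZMod.card p, ZMod.χ₄_eq_neg_one_pow hodd]
    push_cast
    rfl
  -- `√p*² = s²`
  have hsq : geomSqrt ((-1 : ℚ) ^ (p / 2) * p) ^ 2 = s ^ 2 := by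
    rw [geomSqrt_sq, hs2, hneg1, map_mul, map_pow, map_neg, map_one, map_natCast]
  rcases sq_eq_sq_iff_eq_or_eq_neg.mp hsq with h | h
  · rw [h, hsτ τ]
  · rw [h, smul_neg, hsτ τ, mul_neg]

variable {v : HeightOneSpectrum (𝓞 ℚ)}

/-- **Local form**: for `σ` in the absolute Galois group of `ℚ_v`, `v ∋ p`,
`res(σ) • √p* = (χ̄_p(σ)/p) · √p*` with the LOCAL mod-`p` cyclotomic character (the characters are
compatible with restriction: `modNCyclotomicCharacter_absGaloisRestrict`).
[cite: IrelandRosen1990, Ch. 6 Prop. 6.3.2] -/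
theorem absGaloisRestrict_smul_geomSqrt_pStar [NeZero ((p : ℕ) : v.adicCompletion ℚ)] (hp2 : p ≠ 2)
    (σ : absoluteGaloisGroup (v.adicCompletion ℚ)) :
    absGaloisRestrict ℚ (v.adicCompletion ℚ) σ • geomSqrt ((-1 : ℚ) ^ (p / 2) * p) =
      ((quadraticChar (ZMod p)
          ((modNCyclotomicCharacter (v.adicCompletion ℚ) p σ : (ZMod p)ˣ) : ZMod p) : ℤ) :
        AlgebraicClosure ℚ) * geomSqrt ((-1 : ℚ) ^ (p / 2) * p) := by
  haveI : NeZero p := ⟨hp.out.ne_zero⟩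
  haveI : NeZero (p : ℚ) := ⟨Nat.cast_ne_zero.mpr hp.out.ne_zero⟩
  rw [smul_geomSqrt_pStar p hp2, modNCyclotomicCharacter_absGaloisRestrict ℚ (v.adicCompletion ℚ) p σ]

/-- **The sign decides the action on `√p*`**: `(χ̄_p(σ)/p) = 1` and `res(σ)√p* = √p*`, or
`(χ̄_p(σ)/p) = −1` and `res(σ)√p* = −√p*`. [cite: IrelandRosen1990, Ch. 6 Prop. 6.3.2] -/
theorem absGaloisRestrict_smul_geomSqrt_pStar_cases [NeZero ((p : ℕ) : v.adicCompletion ℚ)]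
    (hp2 : p ≠ 2) (σ : absoluteGaloisGroup (v.adicCompletion ℚ)) :
    (quadraticChar (ZMod p) ((modNCyclotomicCharacter (v.adicCompletion ℚ) p σ : (ZMod p)ˣ) : ZMod p) = 1 ∧
      absGaloisRestrict ℚ (v.adicCompletion ℚ) σ • geomSqrt ((-1 : ℚ) ^ (p / 2) * p) =
        geomSqrt ((-1 : ℚ) ^ (p / 2) * p)) ∨
    (quadraticChar (ZMod p) ((modNCyclotomicCharacter (v.adicCompletion ℚ) p σ : (ZMod p)ˣ) : ZMod p) = -1 ∧
      absGaloisRestrict ℚ (v.adicCompletion ℚ) σ • geomSqrt ((-1 : ℚ) ^ (p / 2) * p) =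
        -geomSqrt ((-1 : ℚ) ^ (p / 2) * p)) := by
  rcases quadraticChar_dichotomy (F := ZMod p)
    (a := ((modNCyclotomicCharacter (v.adicCompletion ℚ) p σ : (ZMod p)ˣ) : ZMod p)) (Units.ne_zero _)
    with h1 | h1
  · refine Or.inl ⟨h1, ?_⟩
    rw [absGaloisRestrict_smul_geomSqrt_pStar p hp2 σ, h1, Int.cast_one, one_mul]
  · refine Or.inr ⟨h1, ?_⟩
    rw [absGaloisRestrict_smul_geomSqrt_pStar p hp2 σ, h1, Int.cast_neg, Int.cast_one, neg_one_mul]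

end PStar

/-! ### §3 (G-ord, `e = 2`): the transported `C_v` of the good-ordinary `p*`-twist model has the SIGN -/

section Gord

variable (p : ℕ) [hp : Fact p.Prime] {v : HeightOneSpectrum (𝓞 ℚ)}

/-- **The sign on the quotient for a `ℚ`-model `W = C • V^{(p*)}` of the `p*`-twist of a good-ORDINARY
`V`** (`p` odd, `v ∋ p`): SOME ramified ordinary line `L` of `W` at `v` (p10's transport of `C_v(V)`,
B0 §2) has every local inertia element `σ` acting on `W[p^∞]/L.plus` as `(χ̄_p(σ)/p)` (Greenberg
LNM 1716 p. 63: inertia trivial on `V[p^∞]/C_v`; the twisting isomorphism is `χ_{p*} = (χ̄_p/p)`-equivariant).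
[cite: GreenbergLNM1716, §2 pp. 62–63 and p. 69] [cite: SilvermanAEC2009, X.5 Cor. 5.4]
[cite: EmertonPollackWeston2006, §3.1 (eq:ordes) (arXiv:math/0404484 p. 17)] -/
theorem exists_isRamifiedOrdinaryLine_and_sign_of_goodOrd_pStar_twist
    [NeZero ((p : ℕ) : v.adicCompletion ℚ)] (hp2 : p ≠ 2)
    (V : WeierstrassCurve ℚ) [V.IsElliptic] [V.IsGloballyMinimal] {W : WeierstrassCurve ℚ}
    (hCW : ∃ C : VariableChange ℚ, C • V.quadraticTwist ((-1 : ℚ) ^ (p / 2) * p) = W)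
    (hV : GoodOrd V p) (hpv : ((p : ℕ) : 𝓞 ℚ) ∈ v.asIdeal) :
    ∃ L : LocalDatum ℚ ↥(W.geomPrimaryTorsion p) v, IsRamifiedOrdinaryLine W p L ∧
      ∀ σ ∈ absInertia (v.adicCompletion ℚ), ∀ y : ↥(W.geomPrimaryTorsion p),
        absGaloisRestrict ℚ (v.adicCompletion ℚ) σ • y -
          (quadraticChar (ZMod p)
            ((modNCyclotomicCharacter (v.adicCompletion ℚ) p σ : (ZMod p)ˣ) : ZMod p) : ℤ) • y ∈
          L.plus := by
  haveI : NeZero (2 : ℚ) := ⟨two_ne_zero⟩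
  have hΔ : ¬ (p : ℤ) ∣ minimalDiscriminantInt V :=
    V.not_dvd_minimalDiscriminantInt_of_hasGoodReductionAtPrime' p hV.1
  have hord : ¬ (p : ℤ) ∣ V.frobeniusTrace p := hV.2
  obtain ⟨e, he, hepos, heneg⟩ :=
    exists_addEquiv_geomPrimaryTorsion_of_model_twist_sign p V (pStar_ne_zero p) hCW
  obtain ⟨σ₀, hσ₀, hσneg⟩ := exists_mem_absInertia_smul_geomSqrt_pStar_eq_neg p hp2 hpv
  obtain ⟨L₂, hL₂⟩ := exists_localDatum_transport (reductionDatum V p hpv hΔ) e he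
  refine ⟨L₂, isRamifiedOrdinaryLine_of_transport hp2 (reductionDatum V p hpv hΔ) e he L₂ hL₂
    (reductionDatum_divisible V p hpv hΔ hord) (reductionDatum_plus_ne_top V p hpv hΔ hord)
    (reductionDatum_plus_ne_bot V p hpv hΔ hord) (reductionDatum_htriv V p hpv hΔ)
    ⟨σ₀, hσ₀, heneg _ hσneg⟩, ?_⟩
  refine transport_smul_sub_sign_smul_mem (reductionDatum V p hpv hΔ) e L₂ hL₂
    (reductionDatum_htriv V p hpv hΔ) _ fun σ hσ ↦ ?_
  -- the sign of `e` at `res σ` IS the Legendre symbol of `χ̄_p(σ)`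
  rcases absGaloisRestrict_smul_geomSqrt_pStar_cases p hp2 σ with ⟨h1, hfix⟩ | ⟨h1, hneg⟩
  · exact Or.inl ⟨h1, hepos _ hfix⟩
  · exact Or.inr ⟨h1, heneg _ hneg⟩

variable {p} {W : WeierstrassCurve ℚ} [W.IsElliptic] [W.IsGloballyMinimal]

/-- **(G-ord, `e = 2`), `p` odd: SOME ramified ordinary line of `E` at `v ∋ p` has inertia acting on
its quotient as the sign `(χ̄_p/p)`** — class-free binders `TypeGOrd W p ∧ Addv W p ∧ e_E(p) = 2`
(the good-ordinary `p*`-twist model `TypeGOrd.exists_goodOrd_pStar_twist_model`).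
[cite: GreenbergLNM1716, §2 pp. 62–63 and p. 69]
[cite: EmertonPollackWeston2006, §3.1 (eq:ordes) (arXiv:math/0404484 p. 17)] -/
theorem exists_isRamifiedOrdinaryLine_and_sign_of_typeGOrd [NeZero ((p : ℕ) : v.adicCompletion ℚ)]
    (hp2 : p ≠ 2) (hG : TypeGOrd W p) (hadd : Addv W p) (he : semistabilityIndex W p = 2)
    (hpv : ((p : ℕ) : 𝓞 ℚ) ∈ v.asIdeal) :
    ∃ L : LocalDatum ℚ ↥(W.geomPrimaryTorsion p) v, IsRamifiedOrdinaryLine W p L ∧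
      ∀ σ ∈ absInertia (v.adicCompletion ℚ), ∀ y : ↥(W.geomPrimaryTorsion p),
        absGaloisRestrict ℚ (v.adicCompletion ℚ) σ • y -
          (quadraticChar (ZMod p)
            ((modNCyclotomicCharacter (v.adicCompletion ℚ) p σ : (ZMod p)ˣ) : ZMod p) : ℤ) • y ∈
          L.plus := by
  obtain ⟨V, _, _, C, hord, hC⟩ := TypeGOrd.exists_goodOrd_pStar_twist_model W p hp2 hG hadd he
  exact exists_isRamifiedOrdinaryLine_and_sign_of_goodOrd_pStar_twist p hp2 V ⟨C, hC⟩ hord hpv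

end Gord

end RamifiedOrdinaryLineHalfPowerTwo

end Summit.BirchSwinnertonDyer.Rank1Residual.Additive

/-! ### §4 (M): the transported Tate line has the SIGN on its quotient (mod A40/A41) -/

namespace Summit.BirchSwinnertonDyer.Rank1Residual.AdditivePotMult

open Summit.BirchSwinnertonDyer.Rank1Residual.Additive
  Summit.BirchSwinnertonDyer.Rank1Residual.Additive.RamifiedOrdinaryLineHalfPowerTwo
  RamifiedOrdinaryLinePotMult

variable {W : WeierstrassCurve ℚ} [W.IsElliptic] {p : ℕ} [hp : Fact p.Prime]
  {v : HeightOneSpectrum (𝓞 ℚ)}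

/-- **pot-mult(p), odd `p`: SOME ramified ordinary line of `E` at `v ∋ p` has inertia acting on its
quotient as the sign `(χ̄_p/p)`** (mod A40/A41): the transported Tate line of the multiplicative
`p*`-twist model (`exists_isRamifiedOrdinaryLine_shape_of_mult_twist` (2): `res σ • x ∓ x ∈ L.plus`
according as `res σ ∈ galRange ℚ(√p*)` — GV pp. 14–15: the quotient is `D ⊗ χ_{p*}`, `D` unramified),
and `res σ` fixes `√p*` iff `(χ̄_p(σ)/p) = 1` (§2; `res(Γ_K)` is the stabiliser of `√p*`).
[cite: GreenbergVatsal2000, §2 pp. 14–15] [cite: EmertonPollackWeston2006, §3.1 (eq:ordes) (arXiv:math/0404484 p. 17)]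
[cite: SilvermanATAEC1994, Ch. V Thm. 5.3, Cor. 5.4] [cite: IrelandRosen1990, Ch. 6 Prop. 6.3.2] -/
theorem PotMult.exists_isRamifiedOrdinaryLine_and_sign [NeZero ((p : ℕ) : v.adicCompletion ℚ)]
    (hT40 : Silverman1994_thmV53_tateUniformisation.{0})
    (hT41 : Silverman1994_thmV53_corV54_tateUniformisation.{0}) (hpm : PotMult W p) (hp2 : p ≠ 2)
    (hv : ((p : ℕ) : 𝓞 ℚ) ∈ v.asIdeal) :
    ∃ L : LocalDatum ℚ (W.geomPrimaryTorsion p) v, IsRamifiedOrdinaryLine W p L ∧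
      ∀ σ ∈ absInertia (v.adicCompletion ℚ), ∀ y : ↥(W.geomPrimaryTorsion p),
        absGaloisRestrict ℚ (v.adicCompletion ℚ) σ • y -
          (quadraticChar (ZMod p)
            ((modNCyclotomicCharacter (v.adicCompletion ℚ) p σ : (ZMod p)ˣ) : ZMod p) : ℤ) • y ∈
          L.plus := by
  haveI : NeZero (2 : ℚ) := ⟨two_ne_zero⟩
  obtain ⟨V, _, _, C, hV, hC⟩ := hpm.exists_mult_pStar_twist_model hp2
  obtain ⟨K, _, _, hK2, θ, hθ, hθ2⟩ := exists_numberField_sq_eq_pStar hp2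
  obtain ⟨L, hL, hshape, -⟩ := exists_isRamifiedOrdinaryLine_shape_of_mult_twist V K hK2 hθ hθ2 p hC
    hT40 hT41 hp2 hV hv (valuation_pStar p v hv)
  refine ⟨L, hL, fun σ hσ y ↦ ?_⟩
  rcases absGaloisRestrict_smul_geomSqrt_pStar_cases p hp2 σ with ⟨h1, hfix⟩ | ⟨h1, hneg⟩
  · -- `res σ` fixes `√p*`, so lies in `galRange K = res(Γ_K)`: shape `+`
    have hg : absGaloisRestrict ℚ (v.adicCompletion ℚ) σ ∈ galRange (K := ℚ) K :=
      mem_range_absGaloisRestrict_of_smul_geomSqrt hK2 hθ hθ2 hfix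
    rw [h1, one_zsmul]
    exact (hshape σ hσ).1 hg y
  · -- `res σ` negates `√p*`, so lies OFF `galRange K` (which fixes `√p*`): shape `−`
    have hg : absGaloisRestrict ℚ (v.adicCompletion ℚ) σ ∉ galRange (K := ℚ) K := by
      rintro ⟨γ, hγ⟩
      have hfix : absGaloisRestrict ℚ (v.adicCompletion ℚ) σ • geomSqrt ((-1 : ℚ) ^ (p / 2) * p) =
          geomSqrt ((-1 : ℚ) ^ (p / 2) * p) := by
        rw [← hγ]
        exact absGaloisRestrict_smul_geomSqrt hθ2 γ
      exact geomSqrt_ne_neg (pStar_ne_zero p) (hfix.symm.trans hneg)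
    rw [h1, neg_one_zsmul, sub_neg_eq_add]
    exact (hshape σ hσ).2 hg y

end Summit.BirchSwinnertonDyer.Rank1Residual.AdditivePotMult

/-! ### §5 The ENDs: `σ^{(p−1)/2} = 1` on `C[p]` at `p ≡ 3 (mod 4)` for EVERY line of a defect-2 row -/

namespace Literature.NumberTheory.EllipticCurves.EmertonPollackWeston2006.IsRamifiedOrdinaryLine

open Summit.BirchSwinnertonDyer.Rank1Residual.Additive
  Summit.BirchSwinnertonDyer.Rank1Residual.Additive.RamifiedOrdinaryLineHalfPowerTwo

variable {W : WeierstrassCurve ℚ} [W.IsElliptic] [W.IsGloballyMinimal] {p : ℕ} [hp : Fact p.Prime]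
  {v : HeightOneSpectrum (𝓞 ℚ)}

/-- **THE HALF-POWER OF INERTIA IS TRIVIAL ON THE RAMIFIED ORDINARY LINE OF A (G-ord, `e = 2`) ROW AT
`p ≡ 3 (mod 4)` — the (P-def2-odd) producer, TT v2.1's typed statement binder-for-binder.** For `E/ℚ`
globally minimal, additive at `p` of type (G)-ordinary with semistability defect `2`, `p ≡ 3 (mod 4)`,
and ANY ramified ordinary line `L` of `E` at `v ∋ p`: every local inertia element `σ` satisfies
`σ^{(p−1)/2} m = m` for all `m ∈ C = L.plus` killed by `p`: by model-free uniqueness `L` is the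
transported line of §3 (quotient sign `(χ̄_p(σ)/p)`); p16's core `lineHalfPow_of_quotSign` at `n = 1`,
`k = (p−1)/2` odd. (Line character `(χ̄_p/p)·χ̄_p`.) [cite: GreenbergLNM1716, §2 pp. 62–63 and p. 69]
[cite: GreenbergVatsal2000, §2 p. 26] [cite: EmertonPollackWeston2006, §3.1 (eq:ordes) (arXiv:math/0404484 p. 17)] -/
theorem lineHalfPow_of_typeGOrd_of_semistabilityIndex_eq_two (hp3 : p % 4 = 3) (hG : TypeGOrd W p)
    (hadd : Addv W p) (he : semistabilityIndex W p = 2) (hpv : ((p : ℕ) : 𝓞 ℚ) ∈ v.asIdeal)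
    {L : LocalDatum ℚ (W.geomPrimaryTorsion p) v} (hL : IsRamifiedOrdinaryLine W p L) :
    ∀ σ ∈ absInertia (v.adicCompletion ℚ), ∀ m ∈ L.plus, p • m = 0 →
      (absGaloisRestrict ℚ (v.adicCompletion ℚ) σ) ^ ((p - 1) / 2) • m = m := by
  haveI : NeZero ((p : ℕ) : v.adicCompletion ℚ) := ⟨by
    rw [← map_natCast (algebraMap ℚ (v.adicCompletion ℚ))]
    exact (map_ne_zero_iff _ (algebraMap ℚ (v.adicCompletion ℚ)).injective).mpr
      (Nat.cast_ne_zero.mpr hp.out.ne_zero)⟩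
  have hp2 : p ≠ 2 := by omega
  obtain ⟨L', hL', hsign⟩ := exists_isRamifiedOrdinaryLine_and_sign_of_typeGOrd hp2 hG hadd he hpv
  rw [hL.eq_of_isRamifiedOrdinaryLine hL' hpv]
  have hk : Odd ((p - 1) / 2) := by rw [Nat.odd_iff]; omega
  have hnk : 1 * ((p - 1) / 2) = (p - 1) / 2 := one_mul _
  exact hL'.lineHalfPow_of_quotSign hp2 hk hnk fun σ hσ y ↦ by
    rw [pow_one]; exact hsign σ hσ y

end Literature.NumberTheory.EllipticCurves.EmertonPollackWeston2006.IsRamifiedOrdinaryLine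

namespace Summit.BirchSwinnertonDyer.Rank1Residual.AdditivePotMult

open Summit.BirchSwinnertonDyer.Rank1Residual.Additive
  Summit.BirchSwinnertonDyer.Rank1Residual.Additive.RamifiedOrdinaryLineHalfPowerTwo

variable {W : WeierstrassCurve ℚ} [W.IsElliptic] {p : ℕ} [hp : Fact p.Prime]
  {v : HeightOneSpectrum (𝓞 ℚ)}

/-- **pot-mult(p), `p ≡ 3 (mod 4)`: the half-power of inertia is trivial on EVERY ramified ordinary
line's `p`-torsion** (mod A40/A41) — the (M) twin of (P-def2-odd): uniqueness moves §4's sign to the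
given line, then p16's core at `n = 1`, `k = (p−1)/2`. (The line's `p`-torsion is `μ_p ⊗ χ_{p*}`,
character `(χ̄_p/p)·χ̄_p`.) [cite: GreenbergVatsal2000, §2 pp. 14–15 and p. 26]
[cite: EmertonPollackWeston2006, §3.1 (eq:ordes) (arXiv:math/0404484 p. 17)]
[cite: SilvermanATAEC1994, Ch. V Thm. 5.3, Cor. 5.4] -/
theorem PotMult.lineHalfPow (hT40 : Silverman1994_thmV53_tateUniformisation.{0})
    (hT41 : Silverman1994_thmV53_corV54_tateUniformisation.{0}) (hpm : PotMult W p)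
    (hp3 : p % 4 = 3) (hv : ((p : ℕ) : 𝓞 ℚ) ∈ v.asIdeal)
    {L : LocalDatum ℚ (W.geomPrimaryTorsion p) v} (hL : IsRamifiedOrdinaryLine W p L) :
    ∀ σ ∈ absInertia (v.adicCompletion ℚ), ∀ m ∈ L.plus, p • m = 0 →
      (absGaloisRestrict ℚ (v.adicCompletion ℚ) σ) ^ ((p - 1) / 2) • m = m := by
  haveI : NeZero ((p : ℕ) : v.adicCompletion ℚ) := ⟨by
    rw [← map_natCast (algebraMap ℚ (v.adicCompletion ℚ))]
    exact (map_ne_zero_iff _ (algebraMap ℚ (v.adicCompletion ℚ)).injective).mpr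
      (Nat.cast_ne_zero.mpr hp.out.ne_zero)⟩
  have hp2 : p ≠ 2 := by omega
  obtain ⟨L', hL', hsign⟩ := hpm.exists_isRamifiedOrdinaryLine_and_sign hT40 hT41 hp2 hv
  rw [hL.eq_of_isRamifiedOrdinaryLine hL' hv]
  have hk : Odd ((p - 1) / 2) := by rw [Nat.odd_iff]; omega
  have hnk : 1 * ((p - 1) / 2) = (p - 1) / 2 := one_mul _
  exact hL'.lineHalfPow_of_quotSign hp2 hk hnk fun σ hσ y ↦ by
    rw [pow_one]; exact hsign σ hσ y

end Summit.BirchSwinnertonDyer.Rank1Residual.AdditivePotMult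

end
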